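import Summits.QuantumFields.YangMills.Theorems.FluctuationComparisonRegPrIntLS2BetaRelativeSwapDefect
import Literature.MathematicalPhysics.QuantumFieldTheory.Balaban1983to89.BlockAveragingPlaquetteBoundLocal
import HarnessLib

/-!
# S2β · letter (D♮) REL-TEL, feeder F4-rel (UV3-NODE §84.4 (H♭)(iii) «corr-rel»), FILE A2:
# THE RELATIVE CRUDE NON-ABELIAN LATTICE STOKES BOUND FOR CLOSED WORDS
# `dist1 (𝒰⁰_x(w)⁻¹·𝒰_x(w)) ≤ (|w|²∕4)·[ε + 2θ·((|w| + 2)·η)]` — the two-field twin of lit ✓`LatticeWordStokesLocal.dist1_holAt_le_local` — and the relative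
# member loops of the (0.4) block average `dist1 (W_{c,i}(U₀)⁻¹·W_{c,i}(U)) ≤ K·[ε + 2θ·(((d+2)L + 2)·η)]`, `K = ((d+2)L)²∕4`

Cell `ym3-torus` (YM ladder rung R3 = continuum `SU(2)` Yang–Mills on the three-torus — a RUNG: NOT d = 4, NOT infinite volume, NOT a mass gap, NOT Clay).
Width seat «width 21» `ym3-torus-px21` (gen 23), FREE px helper on crux `stmt-QuantumFields-20520` (`Theses.UnitScaleTilt.FluctuationComparisonRegPrIntL`);
registry v11.4 `Cruxes/FluctuationComparisonRegPrIntL/Lines/semiclassical_s2beta.lean` 3732b7df FROZEN, untouched.  `--kind proof --supports stmt-QuantumFields-20520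
--as helper`, count-neutral, DEFINITION-FREE (0 `def`, 0 `instance`, 0 `notation`, 0 `sorry`, default heartbeats).

WHY.  The member-loop half of F4-rel = «corr-rel» (UV3-NODE §84.4 (H♭)(iii); the relative edition of px21 g21 ✓p817406 `…S2BetaCorrLetterL2`, feeder of px12 g24's
REL-TEL dock ✓p822621 through (H♭)): the (0.4) correction factor is `κ_c(U) = ℰ(W_{c,·}(U))` and ✓p812922 `…S2BetaExpMeanLogLipschitz.dist1_avg_mul_inv_le_mean_lin`
(px8 g21) already gives `dist1 (κ_c(U)·κ_c(U₀)⁻¹) ≤ (1 + 4ρ)·mean_i dist1 (W_{c,i}(U)·W_{c,i}(U₀)⁻¹)` on the guard; what was missing is a bound on the RELATIVE member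
loops by relative data — this file — from FILE A1's relative swap defect (✓`…S2BetaRelativeSwapDefect`), in px10 g23's relative currency (✓p822074: `δ(X, X₀) :=
dist1 (X₀⁻¹·X)`, `bdev U U₀ b = U₀(b)⁻¹·U(b)`, the commutator letter `hcomm`, discharged for `SU(N)` by ✓`dist1_comm_le_SU`).

CONTENT ([folklore]; lit ✓`LatticeWordStokes` §3–§6 ∕ ✓`LatticeWordStokesLocal` VERBATIM with `δ(·,·)` for `dist1`; `R_x(w) := dist1 (𝒰⁰_x(w)⁻¹·𝒰_x(w))`).
* §3 ★`dist1_holAt_swap_rel_le_local`: `R_x(A m₁ m₂ C) ≤ [ε + 2θ·((N + 2)·η)] + R_x(A m₂ m₁ C)` for `|A| ≤ N` (lit ✓`holAt_walk_swap_eq` for both fields, FILE A1's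
  relative defect `ε + 4θη`, the commutator defect `2·dist1 D·R_x(A) ≤ 2θ·|A|·η`); ★`dist1_holAt_cancel_rel_le_local` (backtracks free for both fields).
* §4 ★★`dist1_holAt_rel_le_local`: `R_x(w) ≤ (|w|²∕4)·[ε + 2θ·((|w| + 2)·η)]` for every closed word `w`, under the LOCAL hypotheses «in the count box of `w` at `x`:
  plaquettes of `U` `< θ`, relative plaquettes `≤ ε`, bond deviations `≤ η`» (`0 ≤ θ, ε, η`); budget form `…_of_netDisp_eq_zero_local`; global form `dist1_holAt_rel_le`.
* §5 ★★`dist1_loopHol_rel_le_local`: at a coarse bond `c`, `dist1 (W_{c,i}(U₀)⁻¹·W_{c,i}(U)) ≤ K·[ε + 2θ·(((d+2)L + 2)·η)]` under the same three hypotheses on the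
  THREE BLOCKS `B(c₋ − e_μ)`, `B(c₋)`, `B(c₊)` (lit ✓`blockOf_walkEnd_of_count_le_loopWord`); global form `dist1_loopHol_rel_le`; §6 the `SU(N)` readings `…_SU`.
EVERY RIGHT-HAND TERM VANISHES AT `U = U₀` (px10 §82.1's currency test); the background enters only as SIZE (`θ`) × ARC (`η`) — the same-level ARC term is the
«`+ c·θ_j·B_j`» of UV3-NODE §84.4 (v), absorbed by XS algebra in (H♭)'s recursion.

HONEST SCOPE.  Group-theoretic bookkeeping (finite inductions over words); no analysis; nothing of Bałaban's renormalisation analysis is asserted; F4-rel itself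
(FILE B: the `ℓ²` letter through ✓p812922 and the bond-indexed Schur counts), (H♭), (D♮), (F♮), `hIrr`∕`hA`, GAP♯∘ (`stub_uniformFibreGapOrbit`), S2β, the five
registered stubs (0∕5), crux 20520, 19936, 19200 and `YM3TorusSU2` are NOT proved; no registered stub is closed by this helper; rung R3 = SU(2) YM₃ on T³ at
fixed lattice data — NOT d = 4, NOT infinite volume, NOT a mass gap, NOT Clay; the Yang–Mills mass gap is NOT proved.  Sorry-free, axioms standard.
References: T. Bałaban, CMP **98** (1985) 17–51 [Balaban1985Averaging] ((7)–(9) pp.18–19, (19)–(20) p.21); CMP **109** (1987) 249–301 [Balaban1987RG1]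
((0.3)–(0.4) pp.252–253); CMP **99** (1985) 75–102 [Balaban1985RegularSpaces] (Lemma 1 p.79: relative in gauge, absolute in size — px10 §82.4).
-/

set_option autoImplicit false

noncomputable section

namespace Summit.QuantumFields.YangMills.Theorems.FluctuationComparisonRegPrIntLS2BetaRelativeWordStokes

open Literature.MathematicalPhysics.QuantumFieldTheory.Balaban1983to89
open T4Continuum T4ReflectionCone LatticeWordStokes LatticeWordStokesLocal BlockAveraging
open T4TiltOscillation (bdev)
open BlockAveragingPlaquetteBoundLocal (blockOf_walkEnd_of_count_le_loopWord)
open Summit.QuantumFields.YangMills.Theorems.FluctuationComparisonRegPrIntLS2BetaRelativeStokes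
  (dist1_rel_mul_le dist1_rel_conj_le dist1_rel_inv dist1_comm_le_SU)
open Summit.QuantumFields.YangMills.Theorems.FluctuationComparisonRegPrIntLS2BetaRelativeSwapDefect
  (dist1_holAt_walk_rel_le_local dist1_swapDefect_rel_le_local)

variable {P : Params} {j : ℕ} {G : Type*} [GaugeGroup G]

/-! ## §3 The relative swap and the relative cancellation -/

section Steps

variable (U U₀ : GaugeField P j G)

/-- ★ **A RELATIVE ADJACENT TRANSPOSITION COSTS `ε + 2θ·(N + 2)·η`, LOCAL FORM**: for the word `A ++ m₁ :: m₂ :: C` read from `x` with `|A| ≤ N`,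
`R_x(A m₁ m₂ C) ≤ [ε + 2θ·((N + 2)·η)] + R_x(A m₂ m₁ C)` as soon as, for every `u` inside the budget of `A ++ [m₁, m₂]`, the plaquettes `⟨walkEnd x u, a, b⟩`
of `U` are within `θ` of `1` with relative size `≤ ε` and the bonds `⟨walkEnd x u, μ⟩` deviate by `≤ η` (`0 ≤ θ, ε, η`).  The two holonomies differ by the
conjugates `𝒰_x(A)·D·𝒰_x(A)⁻¹` (lit ✓`holAt_walk_swap_eq`, both fields): relative defect `ε + 4θη` (§2) plus the commutator defect
`2·dist1 D·R_x(A) ≤ 2θ·|A|·η` (§1). [cite: Balaban1985Averaging, (19)-(20) p.21] -/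
theorem dist1_holAt_swap_rel_le_local (hcomm : ∀ g h : G, dist1 (g * h * g⁻¹ * h⁻¹) ≤ 2 * dist1 g * dist1 h) {θ ε η : ℝ}
    (hθ0 : 0 ≤ θ) (hε0 : 0 ≤ ε) (hη0 : 0 ≤ η) (x : Site P j) (A C : List (Letter P.d)) (m₁ m₂ : Letter P.d) {N : ℕ}
    (hA : A.length ≤ N)
    (hθ : ∀ u : List (Letter P.d), (∀ l, u.count l ≤ (A ++ [m₁, m₂]).count l) →
      ∀ (a b : Fin P.d) (hab : a < b), dist1 (GaugeField.plaqHol U ⟨walkEnd x u, a, b, hab⟩) < θ)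
    (hε : ∀ u : List (Letter P.d), (∀ l, u.count l ≤ (A ++ [m₁, m₂]).count l) →
      ∀ (a b : Fin P.d) (hab : a < b),
        dist1 ((GaugeField.plaqHol U₀ ⟨walkEnd x u, a, b, hab⟩)⁻¹ * GaugeField.plaqHol U ⟨walkEnd x u, a, b, hab⟩) ≤ ε)
    (hη : ∀ u : List (Letter P.d), (∀ l, u.count l ≤ (A ++ [m₁, m₂]).count l) →
      ∀ μ : Fin P.d, dist1 (bdev U U₀ ⟨walkEnd x u, μ⟩) ≤ η) :
    dist1 ((holAt U₀ (walk x (A ++ m₁ :: m₂ :: C)))⁻¹ * holAt U (walk x (A ++ m₁ :: m₂ :: C))) ≤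
      (ε + 2 * θ * ((N + 2 : ℝ) * η)) +
        dist1 ((holAt U₀ (walk x (A ++ m₂ :: m₁ :: C)))⁻¹ * holAt U (walk x (A ++ m₂ :: m₁ :: C))) := by
  rw [holAt_walk_swap_eq U x A C m₁ m₂, holAt_walk_swap_eq U₀ x A C m₁ m₂]
  refine (dist1_rel_mul_le _ _ _ _).trans (add_le_add ?_ le_rfl)
  refine (dist1_rel_conj_le hcomm _ _ _ _).trans ?_
  -- the budget of `u` read from `walkEnd x A` is the budget of `A ++ u` read from `x`
  have hbud : ∀ u : List (Letter P.d), (∀ l, u.count l ≤ [m₁, m₂].count l) → ∀ l, (A ++ u).count l ≤ (A ++ [m₁, m₂]).count l := by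
    intro u hu l
    rw [List.count_append, List.count_append]
    exact Nat.add_le_add_left (hu l) _
  have hD := dist1_swapDefect_rel_le_local U U₀ hcomm hθ0 hε0 hη0 (walkEnd x A) m₁ m₂
    (fun u hu a b hab => by rw [← walkEnd_append]; exact hθ (A ++ u) (hbud u hu) a b hab)
    (fun u hu a b hab => by rw [← walkEnd_append]; exact hε (A ++ u) (hbud u hu) a b hab)
    (fun u hu μ => by rw [← walkEnd_append]; exact hη (A ++ u) (hbud u hu) μ)
  have hDθ := dist1_swapDefect_le_local U hθ0 (walkEnd x A) m₁ m₂
    (fun u hu a b hab => by rw [← walkEnd_append]; exact hθ (A ++ u) (hbud u hu) a b hab)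
  have hsubA : A.Sublist (A ++ [m₁, m₂]) := List.sublist_append_left A _
  have hT := dist1_holAt_walk_rel_le_local U U₀ A x (fun u hu μ => hη u (fun l => (hu l).trans (hsubA.count_le l)) μ)
  have hT0 : 0 ≤ dist1 ((holAt U₀ (walk x A))⁻¹ * holAt U (walk x A)) := GaugeGroup.dist1_nonneg _
  have hD0 : 0 ≤ dist1 (holAt U (walk (walkEnd x A) [m₁, m₂]) * (holAt U (walk (walkEnd x A) [m₂, m₁]))⁻¹) := GaugeGroup.dist1_nonneg _
  have hAN : (A.length : ℝ) ≤ N := by exact_mod_cast hA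
  have h2 : 2 * dist1 (holAt U (walk (walkEnd x A) [m₁, m₂]) * (holAt U (walk (walkEnd x A) [m₂, m₁]))⁻¹) *
      dist1 ((holAt U₀ (walk x A))⁻¹ * holAt U (walk x A)) ≤ 2 * θ * ((N : ℝ) * η) := by
    calc 2 * dist1 (holAt U (walk (walkEnd x A) [m₁, m₂]) * (holAt U (walk (walkEnd x A) [m₂, m₁]))⁻¹) *
          dist1 ((holAt U₀ (walk x A))⁻¹ * holAt U (walk x A))
        ≤ 2 * θ * ((A.length : ℝ) * η) :=
          mul_le_mul (mul_le_mul_of_nonneg_left hDθ zero_le_two) hT hT0 (mul_nonneg zero_le_two hθ0)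
      _ ≤ 2 * θ * ((N : ℝ) * η) :=
          mul_le_mul_of_nonneg_left (mul_le_mul_of_nonneg_right hAN hη0) (mul_nonneg zero_le_two hθ0)
  calc dist1 ((holAt U₀ (walk (walkEnd x A) [m₁, m₂]) * (holAt U₀ (walk (walkEnd x A) [m₂, m₁]))⁻¹)⁻¹ *
          (holAt U (walk (walkEnd x A) [m₁, m₂]) * (holAt U (walk (walkEnd x A) [m₂, m₁]))⁻¹)) +
        2 * dist1 (holAt U (walk (walkEnd x A) [m₁, m₂]) * (holAt U (walk (walkEnd x A) [m₂, m₁]))⁻¹) *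
          dist1 ((holAt U₀ (walk x A))⁻¹ * holAt U (walk x A))
      ≤ (ε + 2 * θ * (2 * η)) + 2 * θ * ((N : ℝ) * η) := add_le_add hD h2
    _ = ε + 2 * θ * ((N + 2 : ℝ) * η) := by ring

/-- ★ **MOVING `m̄` LEFTWARD THROUGH `B` TO ITS PARTNER `m` COSTS `|B|` RELATIVE TRANSPOSITIONS, LOCAL FORM**: for the word `A m B m̄ C` read from `x` with
`|A| + |B| ≤ N`, `R_x(A m B m̄ C) ≤ |B|·[ε + 2θ·((N + 2)·η)] + R_x(A B C)` under the three local hypotheses on the budget of `A m B m̄ C` — backtracks are free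
for BOTH fields (lit ✓`holAt_walk_backtrack`). [cite: Balaban1985Averaging, (7) p.18 and (19)-(20) p.21] -/
theorem dist1_holAt_cancel_rel_le_local (hcomm : ∀ g h : G, dist1 (g * h * g⁻¹ * h⁻¹) ≤ 2 * dist1 g * dist1 h) {θ ε η : ℝ}
    (hθ0 : 0 ≤ θ) (hε0 : 0 ≤ ε) (hη0 : 0 ≤ η) (x : Site P j) (m : Letter P.d) {N : ℕ} :
    ∀ (B A C : List (Letter P.d)), A.length + B.length ≤ N →
      (∀ u : List (Letter P.d), (∀ l, u.count l ≤ (A ++ m :: (B ++ m.flip :: C)).count l) →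
        ∀ (a b : Fin P.d) (hab : a < b), dist1 (GaugeField.plaqHol U ⟨walkEnd x u, a, b, hab⟩) < θ) →
      (∀ u : List (Letter P.d), (∀ l, u.count l ≤ (A ++ m :: (B ++ m.flip :: C)).count l) →
        ∀ (a b : Fin P.d) (hab : a < b),
          dist1 ((GaugeField.plaqHol U₀ ⟨walkEnd x u, a, b, hab⟩)⁻¹ * GaugeField.plaqHol U ⟨walkEnd x u, a, b, hab⟩) ≤ ε) →
      (∀ u : List (Letter P.d), (∀ l, u.count l ≤ (A ++ m :: (B ++ m.flip :: C)).count l) →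
        ∀ μ : Fin P.d, dist1 (bdev U U₀ ⟨walkEnd x u, μ⟩) ≤ η) →
      dist1 ((holAt U₀ (walk x (A ++ m :: (B ++ m.flip :: C))))⁻¹ * holAt U (walk x (A ++ m :: (B ++ m.flip :: C)))) ≤
        (B.length : ℝ) * (ε + 2 * θ * ((N + 2 : ℝ) * η)) +
          dist1 ((holAt U₀ (walk x (A ++ (B ++ C))))⁻¹ * holAt U (walk x (A ++ (B ++ C))))
  | [], A, C, _, _, _, _ => by
    simp only [List.nil_append, List.length_nil, Nat.cast_zero, zero_mul, zero_add]
    rw [holAt_walk_backtrack, holAt_walk_backtrack]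
  | b :: B, A, C, hN, hθ, hε, hη => by
    have h₁ : A ++ b :: m :: (B ++ m.flip :: C) = (A ++ [b]) ++ m :: (B ++ m.flip :: C) := by simp
    have h₂ : A ++ (b :: B ++ C) = (A ++ [b]) ++ (B ++ C) := by simp
    -- the budget of the swapped word `A b m (B m̄ C)` equals the budget of the current word (a permutation)
    have hperm : (A ++ b :: m :: (B ++ m.flip :: C)).Perm (A ++ m :: (b :: B ++ m.flip :: C)) :=
      List.Perm.append_left A (List.Perm.swap m b _)
    have hsub : (A ++ [m, b]).Sublist (A ++ m :: (b :: B ++ m.flip :: C)) :=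
      (List.Sublist.refl A).append (List.Sublist.cons_cons _ (List.Sublist.cons_cons _ (List.nil_sublist _)))
    have hAN : A.length ≤ N := by simp only [List.length_cons] at hN; omega
    have hAN' : (A ++ [b]).length + B.length ≤ N := by
      simp only [List.length_cons, List.length_append, List.length_nil] at hN ⊢; omega
    calc dist1 ((holAt U₀ (walk x (A ++ m :: (b :: B ++ m.flip :: C))))⁻¹ * holAt U (walk x (A ++ m :: (b :: B ++ m.flip :: C))))
        ≤ (ε + 2 * θ * ((N + 2 : ℝ) * η)) +
            dist1 ((holAt U₀ (walk x (A ++ b :: m :: (B ++ m.flip :: C))))⁻¹ * holAt U (walk x (A ++ b :: m :: (B ++ m.flip :: C)))) :=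
          dist1_holAt_swap_rel_le_local U U₀ hcomm hθ0 hε0 hη0 x A _ m b hAN
            (fun u hu a b' hab => hθ u (fun l => (hu l).trans (hsub.count_le l)) a b' hab)
            (fun u hu a b' hab => hε u (fun l => (hu l).trans (hsub.count_le l)) a b' hab)
            (fun u hu μ => hη u (fun l => (hu l).trans (hsub.count_le l)) μ)
      _ ≤ (ε + 2 * θ * ((N + 2 : ℝ) * η)) + ((B.length : ℝ) * (ε + 2 * θ * ((N + 2 : ℝ) * η)) +
            dist1 ((holAt U₀ (walk x (A ++ (b :: B ++ C))))⁻¹ * holAt U (walk x (A ++ (b :: B ++ C))))) := by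
          rw [h₁, h₂]
          refine add_le_add le_rfl (dist1_holAt_cancel_rel_le_local hcomm hθ0 hε0 hη0 x m B (A ++ [b]) C hAN' ?_ ?_ ?_)
          · intro u hu a b' hab
            refine hθ u (fun l => (hu l).trans_eq ?_) a b' hab
            rw [← h₁]; exact hperm.count_eq l
          · intro u hu a b' hab
            refine hε u (fun l => (hu l).trans_eq ?_) a b' hab
            rw [← h₁]; exact hperm.count_eq l
          · intro u hu μ
            refine hη u (fun l => (hu l).trans_eq ?_) μ
            rw [← h₁]; exact hperm.count_eq l
      _ = ((b :: B).length : ℝ) * (ε + 2 * θ * ((N + 2 : ℝ) * η)) +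
            dist1 ((holAt U₀ (walk x (A ++ (b :: B ++ C))))⁻¹ * holAt U (walk x (A ++ (b :: B ++ C)))) := by
          simp only [List.length_cons, Nat.cast_succ]
          ring

end Steps

/-! ## §4 The relative bound for closed words -/

section Main

variable (U U₀ : GaugeField P j G)

/-- A word with positive net displacement in direction `a` contains the letter `+e_a`; with negative, the letter `−e_a` (lit `LatticeWordStokes` §5, private
there). [folklore] -/
private theorem mem_of_netDisp_ne (a : Fin P.d) : ∀ (w : List (Letter P.d)),
    (0 < netDisp w a → (a, true) ∈ w) ∧ (netDisp w a < 0 → (a, false) ∈ w)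
  | [] => by simp [netDisp]
  | l :: w => by
    obtain ⟨hpos, hneg⟩ := mem_of_netDisp_ne a w
    obtain ⟨b, s⟩ := l
    constructor
    · intro h
      rw [netDisp_cons] at h
      by_cases hb : b = a
      · subst hb
        cases s
        · exact List.mem_cons_of_mem _ (hpos (by simp at h; linarith))
        · exact List.mem_cons_self
      · exact List.mem_cons_of_mem _ (hpos (by simp [hb] at h; exact h))
    · intro h
      rw [netDisp_cons] at h
      by_cases hb : b = a
      · subst hb
        cases s
        · exact List.mem_cons_self
        · exact List.mem_cons_of_mem _ (hneg (by simp at h; linarith))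
      · exact List.mem_cons_of_mem _ (hneg (by simp [hb] at h; exact h))

/-- The tail of a closed word beginning with `m` contains `m̄`. [folklore] -/
private theorem flip_mem_of_netDisp_eq_zero (m : Letter P.d) (w : List (Letter P.d)) (h : netDisp (m :: w) m.1 = 0) : m.flip ∈ w := by
  obtain ⟨a, s⟩ := m
  rw [netDisp_cons] at h
  simp only [if_true] at h
  cases s
  · exact (mem_of_netDisp_ne a w).1 (by simp at h; linarith)
  · exact (mem_of_netDisp_ne a w).2 (by simp at h; linarith)

/-- Removing a cancelling pair `m … m̄` keeps every net displacement. [folklore] -/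
private theorem netDisp_remove_pair (m : Letter P.d) (B C : List (Letter P.d)) (ν : Fin P.d) :
    netDisp (m :: (B ++ m.flip :: C)) ν = netDisp (B ++ C) ν := by
  obtain ⟨a, s⟩ := m
  simp only [netDisp_cons, netDisp_append, Letter.flip]
  by_cases ha : a = ν
  · subst ha; cases s <;> simp <;> ring
  · simp [ha]

/-- **THE RELATIVE CRUDE NON-ABELIAN LATTICE STOKES BOUND, LOCAL FORM, with a budget.**  Fix a base `x`, a budget word `W`, `N : ℕ` and `0 ≤ θ, ε, η`, and suppose
that for every `u` using each letter at most as often as `W`: the plaquettes `⟨walkEnd x u, a, b⟩` of `U` are within `θ` of `1`, their relative sizes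
`dist1 (U₀(∂·)⁻¹·U(∂·))` are `≤ ε`, and the bonds `⟨walkEnd x u, μ⟩` deviate by `≤ η`.  Then for every word `w` inside the budget, of length `n ≤ N`, with zero net
displacement in every direction, `R_x(w) ≤ (n²∕4)·[ε + 2θ·((N + 2)·η)]` — lit ✓`dist1_holAt_le_of_netDisp_eq_zero_local`'s induction with the relative
cancellation §3 (`(n − 2) + (n − 2)²∕4 ≤ n²∕4`). [cite: Balaban1985Averaging, (9) p.19 and (19)-(20) p.21] -/
theorem dist1_holAt_rel_le_of_netDisp_eq_zero_local (hcomm : ∀ g h : G, dist1 (g * h * g⁻¹ * h⁻¹) ≤ 2 * dist1 g * dist1 h) {θ ε η : ℝ}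
    (hθ0 : 0 ≤ θ) (hε0 : 0 ≤ ε) (hη0 : 0 ≤ η) (x : Site P j) (W : List (Letter P.d)) (N : ℕ)
    (hθ : ∀ u : List (Letter P.d), (∀ l, u.count l ≤ W.count l) →
      ∀ (a b : Fin P.d) (hab : a < b), dist1 (GaugeField.plaqHol U ⟨walkEnd x u, a, b, hab⟩) < θ)
    (hε : ∀ u : List (Letter P.d), (∀ l, u.count l ≤ W.count l) →
      ∀ (a b : Fin P.d) (hab : a < b),
        dist1 ((GaugeField.plaqHol U₀ ⟨walkEnd x u, a, b, hab⟩)⁻¹ * GaugeField.plaqHol U ⟨walkEnd x u, a, b, hab⟩) ≤ ε)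
    (hη : ∀ u : List (Letter P.d), (∀ l, u.count l ≤ W.count l) → ∀ μ : Fin P.d, dist1 (bdev U U₀ ⟨walkEnd x u, μ⟩) ≤ η) :
    ∀ (n : ℕ) (w : List (Letter P.d)), w.length = n → n ≤ N → (∀ l, w.count l ≤ W.count l) → (∀ ν, netDisp w ν = 0) →
      dist1 ((holAt U₀ (walk x w))⁻¹ * holAt U (walk x w)) ≤ ((n : ℝ) ^ 2 / 4) * (ε + 2 * θ * ((N + 2 : ℝ) * η)) := by
  intro n
  induction n using Nat.strong_induction_on with
  | _ n ih =>
    intro w hlen hnN hbud hnull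
    have hκ0 : 0 ≤ ε + 2 * θ * ((N + 2 : ℝ) * η) := by positivity
    cases w with
    | nil =>
      subst hlen
      simp only [walk, holAt_nil, inv_one, one_mul, GaugeGroup.dist1_one]
      positivity
    | cons m w' =>
      have hmem : m.flip ∈ w' := flip_mem_of_netDisp_eq_zero m w' (hnull m.1)
      obtain ⟨B, C, hw'⟩ := List.append_of_mem hmem
      subst hw'
      simp only [List.length_cons, List.length_append] at hlen
      have h2n : 2 ≤ n := by omega
      have hBN : ([] : List (Letter P.d)).length + B.length ≤ N := by simp; omega
      have hbud' : ∀ l, ([] ++ m :: (B ++ m.flip :: C)).count l ≤ W.count l := fun l => by simpa using hbud l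
      have hstep := dist1_holAt_cancel_rel_le_local U U₀ hcomm hθ0 hε0 hη0 x m B [] C hBN
        (fun u hu a b hab => hθ u (fun l => (hu l).trans (hbud' l)) a b hab)
        (fun u hu a b hab => hε u (fun l => (hu l).trans (hbud' l)) a b hab)
        (fun u hu μ => hη u (fun l => (hu l).trans (hbud' l)) μ)
      simp only [List.nil_append] at hstep
      have hnull' : ∀ ν, netDisp (B ++ C) ν = 0 := fun ν => by rw [← netDisp_remove_pair m B C ν]; exact hnull ν
      have hsub : (B ++ C).Sublist (m :: (B ++ m.flip :: C)) :=
        (((List.Sublist.refl B).append (List.sublist_cons_self m.flip C))).trans (List.sublist_cons_self m _)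
      have hbud'' : ∀ l, (B ++ C).count l ≤ W.count l := fun l => (hsub.count_le l).trans (hbud l)
      have hlen' : (B ++ C).length = n - 2 := by simp; omega
      have ih' := ih (n - 2) (by omega) (B ++ C) hlen' (by omega) hbud'' hnull'
      have hB : (B.length : ℝ) ≤ (n : ℝ) - 2 := by
        have h : (B.length : ℝ) + 2 ≤ n := by exact_mod_cast (show B.length + 2 ≤ n by omega)
        linarith
      have hcast : (((n - 2 : ℕ) : ℝ)) = (n : ℝ) - 2 := by rw [Nat.cast_sub h2n]; norm_num
      calc dist1 ((holAt U₀ (walk x (m :: (B ++ m.flip :: C))))⁻¹ * holAt U (walk x (m :: (B ++ m.flip :: C))))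
          ≤ (B.length : ℝ) * (ε + 2 * θ * ((N + 2 : ℝ) * η)) + dist1 ((holAt U₀ (walk x (B ++ C)))⁻¹ * holAt U (walk x (B ++ C))) :=
            hstep
        _ ≤ ((n : ℝ) - 2) * (ε + 2 * θ * ((N + 2 : ℝ) * η)) + ((((n - 2 : ℕ) : ℝ)) ^ 2 / 4) * (ε + 2 * θ * ((N + 2 : ℝ) * η)) :=
            add_le_add (mul_le_mul_of_nonneg_right hB hκ0) ih'
        _ ≤ ((n : ℝ) ^ 2 / 4) * (ε + 2 * θ * ((N + 2 : ℝ) * η)) := by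
            rw [hcast, ← add_mul]
            refine mul_le_mul_of_nonneg_right ?_ hκ0
            nlinarith

/-- ★★ **THE RELATIVE CRUDE LATTICE STOKES BOUND, LOCAL FORM, the word's own budget**: if `w` has zero net displacement in every direction and, for every `u` with
`u.count ≤ w.count`, the plaquettes `⟨walkEnd x u, a, b⟩` of `U` are within `θ` of `1` with relative size `≤ ε` and the bonds `⟨walkEnd x u, μ⟩` deviate by `≤ η`
(`0 ≤ θ, ε, η`), then **`dist1 (𝒰⁰_x(w)⁻¹·𝒰_x(w)) ≤ (|w|²∕4)·[ε + 2θ·((|w| + 2)·η)]`** — every term vanishes at `U = U₀`; the background enters only as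
SIZE (`θ`) × ARC (`η`). [cite: Balaban1985Averaging, (9) p.19 and (19)-(20) p.21] -/
theorem dist1_holAt_rel_le_local (hcomm : ∀ g h : G, dist1 (g * h * g⁻¹ * h⁻¹) ≤ 2 * dist1 g * dist1 h) {θ ε η : ℝ}
    (hθ0 : 0 ≤ θ) (hε0 : 0 ≤ ε) (hη0 : 0 ≤ η) (x : Site P j) (w : List (Letter P.d))
    (hθ : ∀ u : List (Letter P.d), (∀ l, u.count l ≤ w.count l) →
      ∀ (a b : Fin P.d) (hab : a < b), dist1 (GaugeField.plaqHol U ⟨walkEnd x u, a, b, hab⟩) < θ)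
    (hε : ∀ u : List (Letter P.d), (∀ l, u.count l ≤ w.count l) →
      ∀ (a b : Fin P.d) (hab : a < b),
        dist1 ((GaugeField.plaqHol U₀ ⟨walkEnd x u, a, b, hab⟩)⁻¹ * GaugeField.plaqHol U ⟨walkEnd x u, a, b, hab⟩) ≤ ε)
    (hη : ∀ u : List (Letter P.d), (∀ l, u.count l ≤ w.count l) → ∀ μ : Fin P.d, dist1 (bdev U U₀ ⟨walkEnd x u, μ⟩) ≤ η)
    (hw : ∀ ν, netDisp w ν = 0) :
    dist1 ((holAt U₀ (walk x w))⁻¹ * holAt U (walk x w)) ≤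
      ((w.length : ℝ) ^ 2 / 4) * (ε + 2 * θ * ((w.length + 2 : ℝ) * η)) :=
  dist1_holAt_rel_le_of_netDisp_eq_zero_local U U₀ hcomm hθ0 hε0 hη0 x w w.length hθ hε hη w.length w rfl le_rfl (fun _ => le_rfl) hw

/-- ★★ **THE RELATIVE CRUDE LATTICE STOKES BOUND, GLOBAL FORM**: under `PlaqSmall θ U`, `∀ p, dist1 (U₀(∂p)⁻¹·U(∂p)) ≤ ε` and `∀ b, dist1 (U₀(b)⁻¹·U(b)) ≤ η`
(`0 ≤ θ, ε, η`), every closed word `w` and base `x` have `dist1 (𝒰⁰_x(w)⁻¹·𝒰_x(w)) ≤ (|w|²∕4)·[ε + 2θ·((|w| + 2)·η)]`. [cite: Balaban1985Averaging, (9) p.19 and (19)-(20) p.21] -/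
theorem dist1_holAt_rel_le (hcomm : ∀ g h : G, dist1 (g * h * g⁻¹ * h⁻¹) ≤ 2 * dist1 g * dist1 h) {θ ε η : ℝ}
    (hθ0 : 0 ≤ θ) (hε0 : 0 ≤ ε) (hη0 : 0 ≤ η) (hθ : PlaqSmall θ U)
    (hε : ∀ p : Plaq P j, dist1 ((GaugeField.plaqHol U₀ p)⁻¹ * GaugeField.plaqHol U p) ≤ ε)
    (hη : ∀ b : PBond P j, dist1 (bdev U U₀ b) ≤ η) (w : List (Letter P.d)) (hw : ∀ ν, netDisp w ν = 0) (x : Site P j) :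
    dist1 ((holAt U₀ (walk x w))⁻¹ * holAt U (walk x w)) ≤
      ((w.length : ℝ) ^ 2 / 4) * (ε + 2 * θ * ((w.length + 2 : ℝ) * η)) :=
  dist1_holAt_rel_le_local U U₀ hcomm hθ0 hε0 hη0 x w (fun _ _ _ _ _ => hθ _) (fun _ _ _ _ _ => hε _) (fun _ _ _ => hη _) hw

end Main

/-! ## §5 The (0.4) loop words: the relative member loops of the block average -/

section LoopWords

variable (U U₀ : GaugeField P j G)

/-- The bound `(n²∕4)·[ε + 2θ·((n + 2)·η)]` is monotone in the length `n`. [folklore] -/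
private theorem relBound_mono {θ ε η : ℝ} (hθ0 : 0 ≤ θ) (hε0 : 0 ≤ ε) (hη0 : 0 ≤ η) {n m : ℝ} (hn : 0 ≤ n) (hnm : n ≤ m) :
    (n ^ 2 / 4) * (ε + 2 * θ * ((n + 2) * η)) ≤ (m ^ 2 / 4) * (ε + 2 * θ * ((m + 2) * η)) := by
  have h1 : n ^ 2 / 4 ≤ m ^ 2 / 4 := by nlinarith
  have h3 : (n + 2) * η ≤ (m + 2) * η := mul_le_mul_of_nonneg_right (by linarith) hη0
  have h2 : ε + 2 * θ * ((n + 2) * η) ≤ ε + 2 * θ * ((m + 2) * η) := by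
    have := mul_le_mul_of_nonneg_left h3 (mul_nonneg zero_le_two hθ0)
    linarith
  exact mul_le_mul h1 h2 (by positivity) (by positivity)

/-- ★★ **THE RELATIVE (0.4) MEMBER LOOPS, LOCAL FORM**: for a coarse bond `c = ⟨y, y + e_μ⟩` (standing range `j + 1 ≤ m + K`) and every member index `i`,
`dist1 (W_{c,i}(U₀)⁻¹·W_{c,i}(U)) ≤ K·[ε + 2θ·(((d+2)L + 2)·η)]`, `K = ((d+2)L)²∕4`, as soon as on the THREE BLOCKS `B(y − e_μ)`, `B(y)`, `B(y + e_μ)`: every fine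
plaquette of `U` based there is within `θ` of `1`, every relative plaquette there is `≤ ε`, and every fine bond based there deviates by `≤ η` (`0 ≤ θ, ε, η`) —
the loop words are closed of length `≤ (d+2)L` (lit ✓`length_loopWord_le`, ✓`netDisp_loopWord`) and their count box lies in the three blocks (lit
✓`blockOf_walkEnd_of_count_le_loopWord`). [cite: Balaban1987RG1, (0.3)-(0.4) pp.252-253] -/
theorem dist1_loopHol_rel_le_local (hcomm : ∀ g h : G, dist1 (g * h * g⁻¹ * h⁻¹) ≤ 2 * dist1 g * dist1 h) {θ ε η : ℝ}
    (hθ0 : 0 ≤ θ) (hε0 : 0 ≤ ε) (hη0 : 0 ≤ η) (hj : j + 1 ≤ P.m + P.K) (c : PBond P (j + 1))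
    (hθ : ∀ q : Plaq P j, (blockOf q.src = c.src.unshift c.dir ∨ blockOf q.src = c.src ∨ blockOf q.src = c.tgt) →
      dist1 (GaugeField.plaqHol U q) < θ)
    (hε : ∀ q : Plaq P j, (blockOf q.src = c.src.unshift c.dir ∨ blockOf q.src = c.src ∨ blockOf q.src = c.tgt) →
      dist1 ((GaugeField.plaqHol U₀ q)⁻¹ * GaugeField.plaqHol U q) ≤ ε)
    (hη : ∀ b : PBond P j, (blockOf b.src = c.src.unshift c.dir ∨ blockOf b.src = c.src ∨ blockOf b.src = c.tgt) →
      dist1 (bdev U U₀ b) ≤ η) (i : Idx P) :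
    dist1 ((loopHol U₀ c i)⁻¹ * loopHol U c i) ≤
      ((((P.d + 2) * P.L : ℕ) : ℝ) ^ 2 / 4) * (ε + 2 * θ * (((((P.d + 2) * P.L : ℕ) : ℝ) + 2) * η)) := by
  have h := dist1_holAt_rel_le_local U U₀ hcomm hθ0 hε0 hη0 (emb c.src) (loopWord P.L c.dir (off i.1) i.2.1 i.2.2)
    (fun u hu a b hab => hθ ⟨walkEnd (emb c.src) u, a, b, hab⟩ (blockOf_walkEnd_of_count_le_loopWord hj c i u hu))
    (fun u hu a b hab => hε ⟨walkEnd (emb c.src) u, a, b, hab⟩ (blockOf_walkEnd_of_count_le_loopWord hj c i u hu))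
    (fun u hu μ => hη ⟨walkEnd (emb c.src) u, μ⟩ (blockOf_walkEnd_of_count_le_loopWord hj c i u hu))
    (netDisp_loopWord _ _ _ _ _)
  refine h.trans (relBound_mono hθ0 hε0 hη0 (Nat.cast_nonneg _) ?_)
  exact_mod_cast length_loopWord_le c i

/-- ★★ **THE RELATIVE (0.4) MEMBER LOOPS, GLOBAL FORM**: under `PlaqSmall θ U`, `∀ p, dist1 (U₀(∂p)⁻¹·U(∂p)) ≤ ε`, `∀ b, dist1 (U₀(b)⁻¹·U(b)) ≤ η`
(`0 ≤ θ, ε, η`): `dist1 (W_{c,i}(U₀)⁻¹·W_{c,i}(U)) ≤ K·[ε + 2θ·(((d+2)L + 2)·η)]`, `K = ((d+2)L)²∕4`, at every coarse bond and member index. [cite: Balaban1987RG1, (0.4) p.253] -/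
theorem dist1_loopHol_rel_le (hcomm : ∀ g h : G, dist1 (g * h * g⁻¹ * h⁻¹) ≤ 2 * dist1 g * dist1 h) {θ ε η : ℝ}
    (hθ0 : 0 ≤ θ) (hε0 : 0 ≤ ε) (hη0 : 0 ≤ η) (hθ : PlaqSmall θ U)
    (hε : ∀ p : Plaq P j, dist1 ((GaugeField.plaqHol U₀ p)⁻¹ * GaugeField.plaqHol U p) ≤ ε)
    (hη : ∀ b : PBond P j, dist1 (bdev U U₀ b) ≤ η) (c : PBond P (j + 1)) (i : Idx P) :
    dist1 ((loopHol U₀ c i)⁻¹ * loopHol U c i) ≤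
      ((((P.d + 2) * P.L : ℕ) : ℝ) ^ 2 / 4) * (ε + 2 * θ * (((((P.d + 2) * P.L : ℕ) : ℝ) + 2) * η)) := by
  have h := dist1_holAt_rel_le U U₀ hcomm hθ0 hε0 hη0 hθ hε hη (loopWord P.L c.dir (off i.1) i.2.1 i.2.2)
    (netDisp_loopWord _ _ _ _ _) (emb c.src)
  refine h.trans (relBound_mono hθ0 hε0 hη0 (Nat.cast_nonneg _) ?_)
  exact_mod_cast length_loopWord_le c i

end LoopWords

/-! ## §6 The `SU(N)` readings (the commutator letter discharged by ✓`dist1_comm_le_SU`) -/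

section SU

variable {n : Type*} [Fintype n] [DecidableEq n] [Nonempty n]
variable (U U₀ : GaugeField P j (Matrix.specialUnitaryGroup n ℂ))

/-- ★★ **`SU(N)`, LOCAL FORM**: the relative (0.4) member loops at `c` are bounded by `K·[ε + 2θ·(((d+2)L + 2)·η)]` under the three hypotheses on the three blocks
`B(c₋ − e_μ)`, `B(c₋)`, `B(c₊)` (no commutator hypothesis). [cite: Balaban1987RG1, (0.4) p.253] -/
theorem dist1_loopHol_rel_le_local_SU {θ ε η : ℝ} (hθ0 : 0 ≤ θ) (hε0 : 0 ≤ ε) (hη0 : 0 ≤ η) (hj : j + 1 ≤ P.m + P.K)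
    (c : PBond P (j + 1))
    (hθ : ∀ q : Plaq P j, (blockOf q.src = c.src.unshift c.dir ∨ blockOf q.src = c.src ∨ blockOf q.src = c.tgt) →
      dist1 (GaugeField.plaqHol U q) < θ)
    (hε : ∀ q : Plaq P j, (blockOf q.src = c.src.unshift c.dir ∨ blockOf q.src = c.src ∨ blockOf q.src = c.tgt) →
      dist1 ((GaugeField.plaqHol U₀ q)⁻¹ * GaugeField.plaqHol U q) ≤ ε)
    (hη : ∀ b : PBond P j, (blockOf b.src = c.src.unshift c.dir ∨ blockOf b.src = c.src ∨ blockOf b.src = c.tgt) →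
      dist1 (bdev U U₀ b) ≤ η) (i : Idx P) :
    dist1 ((loopHol U₀ c i)⁻¹ * loopHol U c i) ≤
      ((((P.d + 2) * P.L : ℕ) : ℝ) ^ 2 / 4) * (ε + 2 * θ * (((((P.d + 2) * P.L : ℕ) : ℝ) + 2) * η)) :=
  dist1_loopHol_rel_le_local U U₀ dist1_comm_le_SU hθ0 hε0 hη0 hj c hθ hε hη i

/-- ★★ **`SU(N)`, GLOBAL FORM**: under `PlaqSmall θ U`, relative plaquettes `≤ ε`, bond deviations `≤ η` (`0 ≤ θ, ε, η`), every relative (0.4) member loop is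
`≤ K·[ε + 2θ·(((d+2)L + 2)·η)]`. [cite: Balaban1987RG1, (0.4) p.253] -/
theorem dist1_loopHol_rel_le_SU {θ ε η : ℝ} (hθ0 : 0 ≤ θ) (hε0 : 0 ≤ ε) (hη0 : 0 ≤ η) (hθ : PlaqSmall θ U)
    (hε : ∀ p : Plaq P j, dist1 ((GaugeField.plaqHol U₀ p)⁻¹ * GaugeField.plaqHol U p) ≤ ε)
    (hη : ∀ b : PBond P j, dist1 (bdev U U₀ b) ≤ η) (c : PBond P (j + 1)) (i : Idx P) :
    dist1 ((loopHol U₀ c i)⁻¹ * loopHol U c i) ≤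
      ((((P.d + 2) * P.L : ℕ) : ℝ) ^ 2 / 4) * (ε + 2 * θ * (((((P.d + 2) * P.L : ℕ) : ℝ) + 2) * η)) :=
  dist1_loopHol_rel_le U U₀ dist1_comm_le_SU hθ0 hε0 hη0 hθ hε hη c i

end SU

end Summit.QuantumFields.YangMills.Theorems.FluctuationComparisonRegPrIntLS2BetaRelativeWordStokes

end
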